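import Summits.Parity.GeneralizedHardyLittlewood.Theorems.CellParityLawSaving.Negative.CornerSqueeze
import HarnessLib

/-!
# Crux `CellParityLawSaving` (stmt-Parity-18104): non-degeneracy, the size bound and convexity are load-bearing

Negative-side support from the crux disprover (cdisprove seat, cycle 1), continued from
`Negative/CornerSqueeze.lean` (the engine).  Each theorem refutes the crux with ONE hypothesis deleted
(variants written INLINE over the dip vocabulary; no proposition is defined under `Summits/`); all sorry-free.

* `cellParityLawSaving_false_without_nondegeneracy` — `IsNondegenerateSystem Ψ` cannot be dropped: the constant
  form `ψ ≡ p`, `p` prime in `(N, 2N]` (`‖Ψ‖_N ≤ 2`), has `𝔖 = 0` (its partial singular products vanish from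
  `x = p` on — no `limUnder` junk, which is why the one-shot attack found this mutation "inconclusive") but its
  prime cell is the whole box, `2N + 1 >` allowance.
* `cellParityLawSaving_false_without_sizeBound` — `‖Ψ‖_N ≤ L` cannot be dropped (`N₀` before `L`): the shift
  pair `(n, n + w#)` with the primorial chosen AFTER `N` has `𝔖 ≥ ½ Σ_{p ≤ w} 1/p > 4 log² N/c² + 1`
  (tree `singularProduct_shiftPair_ge`), `β_∞ ≥ N`, corner cells `A_{1,2}(N) ≥ cN/log N`, so every corner
  model exceeds `4N ≥ C_j + allowance` and the corner squeeze fails — the size bound is exactly what caps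
  `𝔖 ≲ (log log N)^{t−1}` (tree `stub_singularProduct_le_loglog_pow`).
* `cellParityLawSaving_false_without_convexity` — `Convex ℝ K` cannot be dropped: `K = [-N, N] ∖ ℤ` has
  `β_∞ = N`, `𝔖 = 1`, empty cells, corner models `≥ cN/log N >` allowance once `c (log N)^δ > 1`.
* (Box containment `K ⊆ [-N, N]`: already `Theorems/AbsoluteUpgrade/Negative/CellParityLawSavingLoadBearing`.)

Moral for provers: every cheap inconsistency between lattice content and model is excluded ONLY by the four
hypotheses; with them in place no slip was found (`Cruxes/CellParityLawSaving/Disproof.lean` §3).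
This file does NOT refute the crux. [folklore]
-/

noncomputable section

namespace Summit.Parity.GeneralizedHardyLittlewood.Theorems.CellParityLawSaving.Negative

open scoped BigOperators Classical
open Filter MeasureTheory Finset Literature.NumberTheory.Sieve
open Summit.Parity.GeneralizedHardyLittlewood.Cruxes.FibreHyperbolicity.ModelTransfer (jointCell)
open Summit.Parity.GeneralizedHardyLittlewood.Cruxes.AbsoluteUpgrade.DipMarginRateExchange
  (slowDegree four_le_slowDegree)
open Summit.Parity.GeneralizedHardyLittlewood.Theorems.ModelHyperbolicity.Negative (cell)
open Summit.Parity.GeneralizedHardyLittlewood.Cruxes.AbsoluteUpgrade.NlcCellsAbsoluteClip (roughCell walshForm)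
open Summit.Parity.GeneralizedHardyLittlewood.Theorems.AbsoluteUpgrade
  (roughCell_four_le stub_roughAnatomy exists_corner_lower isNondegenerateSystem_shiftPair
    singularProduct_shiftPair_ge exists_sum_primesLE_inv_ge archFactor_shiftPair_ge)
open Summit.Parity.GeneralizedHardyLittlewood.Theorems.AbsoluteUpgrade.Negative.CellSaving
  (cell_eq_roughCell walsh_fin_one)
open Summit.Parity.GeneralizedHardyLittlewood.Theorems.AbsoluteUpgrade.Negative.FibreAlong
  (jointCell_eq_zero_of_forall_not_mem isNondegenerateSystem_id affLinSize_id archFactor_id_boxMinusLattice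
    realPoint_not_mem_boxMinusLattice)
open Summit.Parity.GeneralizedHardyLittlewood.Theorems.PrimeCellsRelative.Negative.BoxContainment
  (singularProduct_id)

/-! ## Load-bearing hypotheses -/

/-! ### (a) Non-degeneracy: the constant form -/

/-- The constant form with a prime value `p` has a vanishing local factor at `p`. [folklore] -/
theorem localFactor_constForm_self {p : ℕ} (hp : p.Prime) : localFactor (fun _ : Fin 1 => (⟨fun _ => 0, (p : ℤ)⟩ : AffLinForm 1)) p = 0 := by
  rw [OneForm.localFactor_eq _ hp]
  simp

/-- ... hence its partial singular products vanish from `x = p` on, and `𝔖(ψ ≡ p) = 0`. [folklore] -/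
theorem singularProduct_constForm {p : ℕ} (hp : p.Prime) : singularProduct (fun _ : Fin 1 => (⟨fun _ => 0, (p : ℤ)⟩ : AffLinForm 1)) = 0 := by
  have hev : (fun x => singularProductPartial (fun _ : Fin 1 => (⟨fun _ => 0, (p : ℤ)⟩ : AffLinForm 1)) x) =ᶠ[atTop] fun _ => (0 : ℝ) := by
    filter_upwards [eventually_ge_atTop p] with x hx
    unfold singularProductPartial
    exact Finset.prod_eq_zero (Nat.mem_primesLE.mpr ⟨hx, hp⟩) (localFactor_constForm_self hp)
  have hlim : Tendsto (singularProductPartial (fun _ : Fin 1 => (⟨fun _ => 0, (p : ℤ)⟩ : AffLinForm 1))) atTop (nhds 0) :=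
    tendsto_const_nhds.congr' hev.symm
  rw [singularProduct, hlim.limUnder_eq]

/-- `‖(ψ ≡ p)‖_N = p/N ≤ 2` for `0 ≤ p ≤ 2N`. [folklore] -/
theorem affLinSize_constForm {p N : ℕ} (hN : 0 < N) (hp : p ≤ 2 * N) :
    affLinSize (fun _ : Fin 1 => (⟨fun _ => 0, (p : ℤ)⟩ : AffLinForm 1)) N ≤ ((2 : ℕ) : ℝ) := by
  have hN' : (0 : ℝ) < N := by exact_mod_cast hN
  have hp' : (p : ℝ) ≤ 2 * N := by exact_mod_cast hp
  simp only [affLinSize, Fin.sum_univ_one, Int.cast_zero, abs_zero, Finset.sum_const_zero,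
    Int.cast_natCast, zero_add, Nat.cast_ofNat]
  rw [abs_of_nonneg (by positivity), div_le_iff₀ hN']
  exact hp'

/-- On the full box every lattice point sits in the prime cell of `ψ ≡ p` when `N^{1/U} < p`, `p` prime: the
joint cell `j = 1` is the whole box, `2N + 1` points. [folklore] -/
theorem jointCell_constForm {p N u : ℕ} (hp : p.Prime) (hth : (N : ℝ) ^ ((1 : ℝ) / u) < p) :
    jointCell 1 N u (fun _ : Fin 1 => (⟨fun _ => 0, (p : ℤ)⟩ : AffLinForm 1)) (realBox 1 N) (fun _ => 1) = 2 * N + 1 := by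
  unfold jointCell
  rw [Finset.filter_true_of_mem, card_latticeBox_one]
  intro n hn
  refine ⟨?_, fun _ => ?_⟩
  · simp only [latticeBox, Fintype.mem_piFinset, Finset.mem_Icc] at hn
    refine ⟨fun i => ?_, fun i => ?_⟩
    · have := (hn i).1
      show -(N : ℝ) ≤ (n i : ℝ)
      exact_mod_cast this
    · have := (hn i).2
      show (n i : ℝ) ≤ N
      exact_mod_cast this
  · have hev : ((⟨fun _ => 0, (p : ℤ)⟩ : AffLinForm 1).eval n).toNat = p := by
      simp [AffLinForm.eval]
    rw [hev]
    exact ⟨by rw [Nat.Prime.minFac_eq hp]; exact hth, ArithmeticFunction.cardFactors_apply_prime hp⟩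

/-- **Non-degeneracy is load-bearing.** At `t = 1`, `L = 2`: the constant form `ψ ≡ p`, `p` a prime in
`(N, 2N]` (Bertrand), on `K = [-N, N]` has `𝔖 = 0` — every model term vanishes — while its prime cell holds
all `2N + 1` lattice points (`N^{1/U} ≤ N < p`), against an allowance `≤ N`. [folklore] -/
theorem cellParityLawSaving_false_without_nondegeneracy : ¬ (∀ (t L : ℕ), 1 ≤ t → ∃ δ : ℝ, 0 < δ ∧ ∃ N₀ : ℕ, ∀ N : ℕ, N₀ ≤ N →
    ∀ Ψ : Fin t → AffLinForm 1, affLinSize Ψ N ≤ L →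
    ∀ K : Set (Fin 1 → ℝ), Convex ℝ K → K ⊆ realBox 1 N → (∃ θ : Finset (Fin t) → ℝ, θ ∅ = 1 ∧ (∀ S, |θ S| ≤ 2) ∧
          ∀ j : Fin t → ℕ, (∀ i, 1 ≤ j i ∧ j i ≤ slowDegree N) →
            |(jointCell t N (slowDegree N) Ψ K j : ℝ) -
                (∑ S : Finset (Fin t), θ S * ∏ i ∈ S, (-1 : ℝ) ^ (j i + 1)) *
                  (archFactor Ψ K * singularProduct Ψ *
                    ∏ i, (cell (slowDegree N) N (j i) : ℝ) / N)| ≤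
              (N : ℝ) / (Real.log N ^ t * Real.log N ^ δ))) := by
  intro h
  obtain ⟨δ, hδ, N₀, hN₀⟩ := h 1 2 le_rfl
  -- a scale `N ≥ max N₀ 3`
  set N : ℕ := max N₀ 3 with hNdef
  have hNN₀ : N₀ ≤ N := le_max_left _ _
  have hN3 : 3 ≤ N := le_max_right _ _
  have hNpos : 0 < N := by omega
  have hNr : (3 : ℝ) ≤ N := by exact_mod_cast hN3
  obtain ⟨p, hp, hNp, hp2⟩ := Nat.exists_prime_lt_and_le_two_mul N (by omega)
  -- threshold: `N^{1/U} ≤ N < p`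
  have hth : (N : ℝ) ^ ((1 : ℝ) / (slowDegree N : ℕ)) < p := by
    have h1 : (N : ℝ) ^ ((1 : ℝ) / (slowDegree N : ℕ)) ≤ (N : ℝ) ^ (1 : ℝ) := by
      refine Real.rpow_le_rpow_of_exponent_le (by linarith) ?_
      rw [div_le_one (by have := four_le_slowDegree N; positivity)]
      have := four_le_slowDegree N
      exact_mod_cast (show 1 ≤ slowDegree N by omega)
    rw [Real.rpow_one] at h1
    exact h1.trans_lt (by exact_mod_cast hNp)
  obtain ⟨θ, hθ0, -, hj⟩ := hN₀ N hNN₀ (fun _ : Fin 1 => (⟨fun _ => 0, (p : ℤ)⟩ : AffLinForm 1)) (affLinSize_constForm hNpos hp2) (realBox 1 N)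
    (convex_Icc _ _) subset_rfl
  have h1 := hj (fun _ => 1) (fun _ => ⟨le_rfl, by have := four_le_slowDegree N; omega⟩)
  rw [jointCell_constForm hp hth, singularProduct_constForm hp] at h1
  simp only [mul_zero, zero_mul, sub_zero, pow_one] at h1
  have hE : (N : ℝ) / (Real.log N * Real.log N ^ δ) ≤ N := by
    have := allowance_le (N := N) (t := 1) (δ := δ) ?_ hδ.le
    · simpa using this
    · exact (Real.exp_one_lt_d9.le.trans (by norm_num)).trans hNr
  have habs : |((2 * N + 1 : ℕ) : ℝ)| = 2 * N + 1 := by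
    rw [abs_of_nonneg (by positivity)]; push_cast; ring
  rw [habs] at h1
  linarith

/-! ### (a) Size bound: primorial shift pairs -/

/-- **The size bound is load-bearing.** At `t = 2`: for the shift pair `(n, n + w#)` with `½ Σ_{p ≤ w} 1/p >
4 log² N/c²` (chosen after `N`; `c` the corner-cell constant) on `K = [-N, N]`: `β_∞ ≥ N`, `𝔖 ≥ ½ Σ_{p≤w} 1/p`,
`A_1, A_2 ≥ cN/log N`, so every corner model exceeds `4N ≥ (2N+1) + allowance ≥ C_j + allowance`, and the
corner squeeze (`θ_∅ = 1`) is violated.  Moral: any proof uses `L` to cap `𝔖 ≲ (log log N)^{t−1}`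
(tree `stub_singularProduct_le_loglog_pow`). [folklore] -/
theorem cellParityLawSaving_false_without_sizeBound : ¬ (∀ t : ℕ, 1 ≤ t → ∃ δ : ℝ, 0 < δ ∧ ∃ N₀ : ℕ, ∀ N : ℕ, N₀ ≤ N →
    ∀ Ψ : Fin t → AffLinForm 1, IsNondegenerateSystem Ψ →
    ∀ K : Set (Fin 1 → ℝ), Convex ℝ K → K ⊆ realBox 1 N → (∃ θ : Finset (Fin t) → ℝ, θ ∅ = 1 ∧ (∀ S, |θ S| ≤ 2) ∧
          ∀ j : Fin t → ℕ, (∀ i, 1 ≤ j i ∧ j i ≤ slowDegree N) →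
            |(jointCell t N (slowDegree N) Ψ K j : ℝ) -
                (∑ S : Finset (Fin t), θ S * ∏ i ∈ S, (-1 : ℝ) ^ (j i + 1)) *
                  (archFactor Ψ K * singularProduct Ψ *
                    ∏ i, (cell (slowDegree N) N (j i) : ℝ) / N)| ≤
              (N : ℝ) / (Real.log N ^ t * Real.log N ^ δ))) := by
  intro h
  obtain ⟨δ, hδ, N₀, hN₀⟩ := h 2 (by norm_num)
  obtain ⟨c, hc, hcells⟩ := eventually_corner_cells
  obtain ⟨N, hNN₀, hN3, hcell⟩ : ∃ N : ℕ, N₀ ≤ N ∧ 3 ≤ N ∧ ∀ m ∈ ({1, 2} : Finset ℕ),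
      c * (N : ℝ) / Real.log N ≤ (cell (slowDegree N) N m : ℝ) := by
    obtain ⟨N, h1, h2, h3⟩ := ((eventually_ge_atTop N₀).and ((eventually_ge_atTop 3).and hcells)).exists
    exact ⟨N, h1, h2, h3⟩
  have hNr : (3 : ℝ) ≤ N := by exact_mod_cast hN3
  have hNpos : (0 : ℝ) < N := by linarith
  have hlogpos : 0 < Real.log N := Real.log_pos (by linarith)
  -- the primorial shift, chosen after `N`
  set T : ℝ := 4 * Real.log N ^ 2 / c ^ 2 + 1 with hT
  have hTpos : 0 < T := by positivity
  obtain ⟨w, hw2, hw⟩ := exists_sum_primesLE_inv_ge (2 * T)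
  set hh : ℤ := (primorial w : ℤ) with hhh
  have hh0 : hh ≠ 0 := by rw [hhh]; exact_mod_cast (primorial_pos w).ne'
  have hhnn : (0 : ℤ) ≤ hh := by rw [hhh]; positivity
  have hS : T ≤ singularProduct (shiftPairSystem hh) := by
    have := singularProduct_shiftPair_ge hw2
    rw [← hhh] at this
    linarith
  have hA : (N : ℝ) ≤ archFactor (shiftPairSystem hh) (realBox 1 N) := archFactor_shiftPair_ge hhnn N
  -- the law on the shift pair
  obtain ⟨θ, hθ, hdev⟩ := corners_of_conclusion
    (hN₀ N hNN₀ (shiftPairSystem hh) (isNondegenerateSystem_shiftPair hh0) (realBox 1 N) (convex_Icc _ _)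
      subset_rfl)
  -- the squeeze: corner models ≥ T c² N / log² N, corner cells ≤ 2N+1, allowance ≤ N
  set E : ℝ := (N : ℝ) / (Real.log N ^ 2 * Real.log N ^ δ) with hE
  have hE0 : 0 ≤ E := by positivity
  have hEN : E ≤ N := allowance_le ((Real.exp_one_lt_d9.le.trans (by norm_num)).trans hNr) hδ.le
  set P₀ : ℝ := T * (c ^ 2 * N / Real.log N ^ 2) with hP₀
  have hP₀nn : 0 ≤ P₀ := by positivity
  have hB : ℝ := 0
  have hsq := corner_squeeze (t := 2) hθ (C := fun j => (jointCell 2 N (slowDegree N) (shiftPairSystem hh)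
      (realBox 1 N) j : ℝ)) (P := fun j => archFactor (shiftPairSystem hh) (realBox 1 N) * singularProduct (shiftPairSystem hh) *
      ∏ i, (cell (slowDegree N) N (j i) : ℝ) / N) (B := 2 * N + 1) (E := E)
    hP₀nn hE0 (by positivity) hdev (fun j _ => jointCell_le _ _ j) ?_
  · -- contradiction: `T c² N/log² N ≤ 3N + 1 ≤ 4N` against `T > 4 log² N / c²`
    have h4 : P₀ ≤ 4 * N := by linarith
    rw [hP₀, hT] at h4
    have key : (4 * Real.log N ^ 2 / c ^ 2 + 1) * (c ^ 2 * N / Real.log N ^ 2) = 4 * N + c ^ 2 * N / Real.log N ^ 2 := by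
      field_simp
    rw [key] at h4
    have : 0 < c ^ 2 * N / Real.log N ^ 2 := by positivity
    linarith
  · -- corner models ≥ P₀
    intro j hj
    have hc0 : c * (N : ℝ) / Real.log N ≤ (cell (slowDegree N) N (j 0) : ℝ) :=
      hcell (j 0) (Fintype.mem_piFinset.mp hj 0)
    have hc1 : c * (N : ℝ) / Real.log N ≤ (cell (slowDegree N) N (j 1) : ℝ) :=
      hcell (j 1) (Fintype.mem_piFinset.mp hj 1)
    have hcpos : 0 ≤ c * (N : ℝ) / Real.log N := by positivity
    rw [Fin.prod_univ_two]
    have hprod : (c * N / Real.log N / N) * (c * N / Real.log N / N) ≤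
        (cell (slowDegree N) N (j 0) : ℝ) / N * ((cell (slowDegree N) N (j 1) : ℝ) / N) := by
      apply mul_le_mul (div_le_div_of_nonneg_right hc0 hNpos.le) (div_le_div_of_nonneg_right hc1 hNpos.le)
        (by positivity) (by positivity)
    have hsimp : (c * N / Real.log N / N) * (c * N / Real.log N / N) = c ^ 2 / Real.log N ^ 2 := by
      field_simp
    rw [hsimp] at hprod
    calc P₀ = N * T * (c ^ 2 / Real.log N ^ 2) := by rw [hP₀]; field_simp
      _ ≤ archFactor (shiftPairSystem hh) (realBox 1 N) * singularProduct (shiftPairSystem hh) *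
            ((cell (slowDegree N) N (j 0) : ℝ) / N * ((cell (slowDegree N) N (j 1) : ℝ) / N)) := by
          apply mul_le_mul (mul_le_mul hA hS hTpos.le ((Nat.cast_nonneg N).trans hA)) hprod (by positivity)
          exact mul_nonneg ((Nat.cast_nonneg N).trans hA) (hTpos.le.trans hS)

/-! ### (a) Convexity: the box minus its lattice points -/

/-- **Convexity is load-bearing.** At `t = 1`, `L = 1`, `ψ(n) = n` on `K = [-N, N] ∖ ℤ`: `β_∞ = N` (a countable
set is null), `𝔖 = 1`, no lattice point lies in `K` (all cells empty), and the corner models `A_1(N), A_2(N) ≥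
cN/log N` beat the allowance `N/(log N)^{1+δ}` once `c (log N)^δ > 1` — corner squeeze with `B = 0`. [folklore] -/
theorem cellParityLawSaving_false_without_convexity : ¬ (∀ (t L : ℕ), 1 ≤ t → ∃ δ : ℝ, 0 < δ ∧ ∃ N₀ : ℕ, ∀ N : ℕ, N₀ ≤ N →
    ∀ Ψ : Fin t → AffLinForm 1, IsNondegenerateSystem Ψ → affLinSize Ψ N ≤ L →
    ∀ K : Set (Fin 1 → ℝ), K ⊆ realBox 1 N → (∃ θ : Finset (Fin t) → ℝ, θ ∅ = 1 ∧ (∀ S, |θ S| ≤ 2) ∧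
          ∀ j : Fin t → ℕ, (∀ i, 1 ≤ j i ∧ j i ≤ slowDegree N) →
            |(jointCell t N (slowDegree N) Ψ K j : ℝ) -
                (∑ S : Finset (Fin t), θ S * ∏ i ∈ S, (-1 : ℝ) ^ (j i + 1)) *
                  (archFactor Ψ K * singularProduct Ψ *
                    ∏ i, (cell (slowDegree N) N (j i) : ℝ) / N)| ≤
              (N : ℝ) / (Real.log N ^ t * Real.log N ^ δ))) := by
  intro h
  obtain ⟨δ, hδ, N₀, hN₀⟩ := h 1 1 le_rfl
  obtain ⟨c, hc, hcells⟩ := eventually_corner_cells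
  have hTp : Tendsto (fun N : ℕ => Real.log (N : ℝ) ^ δ) atTop atTop :=
    (tendsto_rpow_atTop hδ).comp (Real.tendsto_log_atTop.comp tendsto_natCast_atTop_atTop)
  obtain ⟨N, hNN₀, hN3, hcell, hpow⟩ : ∃ N : ℕ, N₀ ≤ N ∧ 3 ≤ N ∧ (∀ m ∈ ({1, 2} : Finset ℕ),
      c * (N : ℝ) / Real.log N ≤ (cell (slowDegree N) N m : ℝ)) ∧ 1 / c < Real.log (N : ℝ) ^ δ := by
    obtain ⟨N, h1, h2, h3, h4⟩ := ((eventually_ge_atTop N₀).and ((eventually_ge_atTop 3).and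
      (hcells.and (hTp.eventually_gt_atTop (1 / c))))).exists
    exact ⟨N, h1, h2, h3, h4⟩
  have hNr : (3 : ℝ) ≤ N := by exact_mod_cast hN3
  have hNpos : (0 : ℝ) < N := by linarith
  have hlogpos : 0 < Real.log N := Real.log_pos (by linarith)
  have hP : 0 < Real.log N ^ δ := Real.rpow_pos_of_pos hlogpos δ
  set K : Set (Fin 1 → ℝ) := realBox 1 (N : ℝ) \ {x : Fin 1 → ℝ | ∃ m : ℤ, x = fun _ => (m : ℝ)} with hK
  obtain ⟨θ, hθ, hdev⟩ := corners_of_conclusion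
    (hN₀ N hNN₀ (fun _ => ⟨fun _ => 1, 0⟩) isNondegenerateSystem_id (affLinSize_id N) K (fun x hx => hx.1))
  set E : ℝ := (N : ℝ) / (Real.log N ^ 1 * Real.log N ^ δ) with hE
  have hE0 : 0 ≤ E := by positivity
  have hsq := corner_squeeze (t := 1) hθ
    (C := fun j => (jointCell 1 N (slowDegree N) (fun _ => ⟨fun _ => 1, 0⟩) K j : ℝ))
    (P := fun j => archFactor (fun _ : Fin 1 => (⟨fun _ => 1, 0⟩ : AffLinForm 1)) K *
      singularProduct (fun _ : Fin 1 => (⟨fun _ => 1, 0⟩ : AffLinForm 1)) * ∏ i, (cell (slowDegree N) N (j i) : ℝ) / N) (B := 0) (E := E) (P₀ := c * N / Real.log N)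
    (by positivity) hE0 le_rfl hdev ?_ ?_
  · -- `c N/log N ≤ N/(log N · (log N)^δ)` against `c (log N)^δ > 1`
    rw [zero_add, hE, pow_one, div_le_div_iff₀ hlogpos (mul_pos hlogpos hP)] at hsq
    have hcP : 1 < c * Real.log N ^ δ := by
      have := (div_lt_iff₀ hc).mp hpow
      linarith [mul_comm (Real.log (N : ℝ) ^ δ) c]
    nlinarith [mul_lt_mul_of_pos_right hcP (mul_pos hNpos hlogpos), mul_pos hNpos hlogpos]
  · intro j _
    have : jointCell 1 N (slowDegree N) (fun _ => ⟨fun _ => 1, 0⟩) K j = 0 :=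
      jointCell_eq_zero_of_forall_not_mem _ (fun n _ => realPoint_not_mem_boxMinusLattice N n) j
    simp [this]
  · intro j hj
    rw [Fin.prod_univ_one, hK, archFactor_id_boxMinusLattice, singularProduct_id, mul_one]
    have hc0 := hcell (j 0) (Fintype.mem_piFinset.mp hj 0)
    calc c * (N : ℝ) / Real.log N ≤ (cell (slowDegree N) N (j 0) : ℝ) := hc0
      _ = N * ((cell (slowDegree N) N (j 0) : ℝ) / N) := by field_simp

end Summit.Parity.GeneralizedHardyLittlewood.Theorems.CellParityLawSaving.Negative

end
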